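import Literature.AlgebraicGeometry.Resolution.BlowupChartRsop
import HarnessLib

/-!
# Crux `PatchingRelPerfect` (stmt-ResolutionOfSingularities-16161), chain W5.2 — rung «r-cone-ℓ» (the quadric cone at every
# depth), local algebra I: a chart of the blow-up of the closed point, a prime over `𝔪`, and EXTRA ELEMENTS with polynomial
# representatives (regular sequence, dimension count, Matsumura's criterion)

[OURS · L1 W5.2 · rung tool] Replaces the role of NO printed item; NOT a statement of the manuscript under review; fact-free,
any characteristic, any residue field.  AI-written (AI review is weaker than expert review).

The rung «r-cone-ℓ» (res-L1-w52-stub-4 g4, crux `PatchingRelPerfect` stmt-ResolutionOfSingularities-16161, line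
`closed_point_slice`, open stub `stub_atomDimFourBlowup`): the member `I = (x₀x₁ + x₂²) + 𝔪^{ℓ+2}` — the quadric CONE at
exceptional depth `ℓ` — lies in the companion class for EVERY `ℓ ≥ 1`.  It is the minimal family with an `(ℓ, 2)`-DEFICIENT step
(CHAIN v2.1 kernel sentence (v″): the vertex of `V(q̄) ⊂ ℙ³` is an ordinary double point, of weight `2 < ℓ` for `ℓ ≥ 3`), resolved
by `⌈ℓ/2⌉` blowings up of successive vertices (each reproducing the cone on the new exceptional carrier at depth `ℓ - 2`:
`u²·((y₀/u)(y₁/u) + (y₂/u)², u^{ℓ-2})`) followed by the two-monomial END game (`atomConclusion_of_pointwiseTwoMonomial`).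

This file: the ABSTRACT CHART of the tree's `BlowupChartRsop.lean` (regular local `R` with regular system of parameters `c`;
chart data `(A, ψ, u, ε, 𝔓, L)`: `ψ : R → A`, `u_j = c_j/c_i`, `ε : κ[T_j : j ≠ i] ≅ A/(ψ c_i)` — here with RESIDUE-FIELD
coefficients `κ` — a prime `𝔓 ⊂ A` over `𝔪` and `L = A_𝔓`; at the points of a blow-up `L` is the local ring `𝒪_{X',x'}`), with NO
further coordinates (the centre is the closed point) and a family of extra elements `f_k ∈ 𝔓` having polynomial representatives
`F_k ∈ κ[T]` modulo `ψ c_i`: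
* §1 `isRegularLocalRing_quot_map_of_atPrime` — `L/K₀L` is regular if `A/K₀` is regular AT the prime `𝔓/K₀` (local version of
  the tree's `isRegularLocalRing_quot_map_of_isRegularRing`); `isRegularLocalRing_atPrime_of_ringEquiv` (transport).
* §2 `isRsopPart_consFamily` — if the `F_k` form a weakly regular sequence on `κ[T]` and `L/(ψ c_i, f)L` is a regular local
  ring, then `(ψ c_i, f₁, …, f_m)` is part of a regular system of parameters of `L` (regular sequence by flatness of
  `L/(ψ c_i)L` over `κ[T]`, dimension count `Module.supportDim_add_length_eq_supportDim_of_isRegular`, criterion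
  `IsRsopPart.of_isRegularLocalRing_quotient`).
Continued in `…ConeDepthChartKill` (killing chart generators and one hypersurface; Jacobian criterion) and `…ConeDepthConeCharts`
(the cone `q = c₁c₂ + c₃²`).

## References
* H. Matsumura, *Commutative Ring Theory*, CUP 1986, Thm. 14.2 (and the Remark after it), Thm. 17.4. [Matsumura1987]
* The Stacks Project, Tags 0804, 0BIQ (charts of a blowing up, `B_i/(c_i) ≅ (R/I)[T]`). [StacksProject]
* J. Kollár, *Lectures on Resolution of Singularities* (2007), Def. 3.24, (3.111) Step 3. [Kollar2007]
-/

-- `Summit.<Summit>.<Sub>.Theorems` with `Sub = Summit` (single-conjunct summit, D-0017)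
set_option linter.dupNamespace false

noncomputable section

open IsLocalRing Literature.AlgebraicGeometry.Resolution
open scoped Pointwise

namespace Summit.ResolutionOfSingularities.ResolutionOfSingularities.Theorems

universe u v w

namespace ConeDepth

/-! ## §1 Regularity of a quotient of a localisation, read at the prime -/

section QuotAtPrime

variable {A : Type u} [CommRing A] (L : Type u) [CommRing L] (𝔓 : Ideal A) [𝔓.IsPrime]
  [Algebra A L] [IsLocalization.AtPrime L 𝔓]

/-- **`L/K₀L` is a regular local ring if `A/K₀` is regular at the prime `𝔓/K₀`** (`K₀ ⊆ 𝔓`, `L = A_𝔓`): `L/K₀L` is the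
localisation of `A/K₀` at `𝔓/K₀`.  The local version of the tree's `isRegularLocalRing_quot_map_of_isRegularRing`.
[cite: Matsumura1987, Thm. 19.3] -/
theorem isRegularLocalRing_quot_map_of_atPrime (K₀ : Ideal A) (hK : K₀ ≤ 𝔓)
    [(𝔓.map (Ideal.Quotient.mk K₀)).IsPrime]
    [hreg : IsRegularLocalRing (Localization.AtPrime (𝔓.map (Ideal.Quotient.mk K₀)))] :
    IsRegularLocalRing (L ⧸ K₀.map (algebraMap A L)) := by
  set pbar : Ideal (A ⧸ K₀) := 𝔓.map (Ideal.Quotient.mk K₀) with hpbar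
  have hcomap : pbar.comap (Ideal.Quotient.mk K₀) = 𝔓 := by
    rw [hpbar, Ideal.comap_map_of_surjective _ Ideal.Quotient.mk_surjective,
      ← RingHom.ker_eq_comap_bot, Ideal.mk_ker, sup_eq_left]
    exact hK
  have hmem : ∀ x : A, Ideal.Quotient.mk K₀ x ∈ pbar ↔ x ∈ 𝔓 := fun x => by
    rw [← Ideal.mem_comap, hcomap]
  have hM : Algebra.algebraMapSubmonoid (A ⧸ K₀) 𝔓.primeCompl = pbar.primeCompl := by
    ext b
    constructor
    · rintro ⟨x, hx, rfl⟩
      exact fun h => hx ((hmem x).mp h)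
    · intro hb
      obtain ⟨x, rfl⟩ := Ideal.Quotient.mk_surjective b
      exact ⟨x, fun h => hb ((hmem x).mpr h), rfl⟩
  haveI : IsLocalization.AtPrime (L ⧸ K₀.map (algebraMap A L)) pbar := by
    have := (inferInstance : IsLocalization (Algebra.algebraMapSubmonoid (A ⧸ K₀) 𝔓.primeCompl)
      (L ⧸ K₀.map (algebraMap A L)))
    rwa [hM] at this
  exact IsRegularLocalRing.of_ringEquiv (IsLocalization.algEquiv pbar.primeCompl
    (Localization.AtPrime pbar) (L ⧸ K₀.map (algebraMap A L))).toRingEquiv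

omit [IsLocalization.AtPrime L 𝔓] [Algebra A L] in
/-- The image of `𝔓` in `A/K₀` is prime (`K₀ ⊆ 𝔓`). [folklore] -/
theorem isPrime_map_mk (K₀ : Ideal A) (hK : K₀ ≤ 𝔓) : (𝔓.map (Ideal.Quotient.mk K₀)).IsPrime :=
  Ideal.map_isPrime_of_surjective Ideal.Quotient.mk_surjective (by rwa [Ideal.mk_ker])

end QuotAtPrime

/-- **Transport of regularity at a prime along a ring isomorphism**: if `e : A ≃+* A'` and `A` is regular at
`e⁻¹(p')`, then `A'` is regular at `p'`. [folklore] -/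
theorem isRegularLocalRing_atPrime_of_ringEquiv {A : Type u} {A' : Type v} [CommRing A] [CommRing A']
    (e : A ≃+* A') (p' : Ideal A') [p'.IsPrime]
    [h : IsRegularLocalRing (Localization.AtPrime (p'.comap e))] :
    IsRegularLocalRing (Localization.AtPrime p') :=
  IsRegularLocalRing.of_ringEquiv (IsLocalization.ringEquivOfRingEquiv
    (Localization.AtPrime (p'.comap e)) (Localization.AtPrime p') e (e.map_primeCompl_comap_eq p'))

/-! ## §2 The abstract chart with extra elements (`l = 0`: the centre is the closed point) -/

section AbstractChart

variable {R : Type u} [CommRing R] [IsRegularLocalRing R] {n : ℕ} (c : Fin n → R) (i : Fin n)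
  (hz : Ideal.span (Set.range c) = maximalIdeal R) (hd : (maximalIdeal R).spanFinrank = n)
  {A : Type u} [CommRing A] (L : Type u) [CommRing L] (ψ : R →+* A) (u : Fin n → A)
  (hnzd : ψ (c i) ∈ nonZeroDivisors A)
  (ε : MvPolynomial {j : Fin n // j ≠ i} (ResidueField R) ≃+* A ⧸ Ideal.span {ψ (c i)})
  (hεC : ∀ r : R, ε (MvPolynomial.C (residue R r)) = Ideal.Quotient.mk _ (ψ r))
  (hεX : ∀ j : {j : Fin n // j ≠ i}, ε (MvPolynomial.X j) = Ideal.Quotient.mk _ (u j.1))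
  (𝔓 : Ideal A) [𝔓.IsPrime] (h𝔓 : 𝔓.comap ψ = maximalIdeal R)
  [Algebra A L] [IsLocalization.AtPrime L 𝔓]

local notation3 "I" => Ideal.span (Set.range c)
local notation3 "P" => MvPolynomial {j : Fin n // j ≠ i} (ResidueField R)
local notation3 "KA" => Ideal.span {ψ (c i)}
local notation3 "KL" => Ideal.map (algebraMap A L) (Ideal.span {ψ (c i)})
local notation3 "Lb" => L ⧸ KL

include hz in
omit [𝔓.IsPrime] in
/-- `ψ(c_j) ∈ 𝔓`. [folklore] -/
theorem map_centre_mem' (h𝔓 : 𝔓.comap ψ = maximalIdeal R) (j : Fin n) : ψ (c j) ∈ 𝔓 := by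
  have : c j ∈ maximalIdeal R := hz ▸ Ideal.subset_span ⟨j, rfl⟩
  rw [← h𝔓] at this
  exact this

/-- **The candidate family** `(ψ c_i, f₁, …, f_m)` over `1` in `L`. [folklore] -/
def consFamily {m : ℕ} (f : Fin m → A) : Fin (m + 1) → L :=
  Fin.cons (algebraMap A L (ψ (c i))) fun k => algebraMap A L (f k)

omit [IsRegularLocalRing R] [𝔓.IsPrime] [IsLocalization.AtPrime L 𝔓] in
/-- The list of `consFamily`. [folklore] -/
theorem ofFn_consFamily {m : ℕ} (f : Fin m → A) :
    List.ofFn (consFamily c i L ψ f) = algebraMap A L (ψ (c i)) :: List.ofFn fun k => algebraMap A L (f k) := by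
  rw [consFamily, List.ofFn_cons]

omit [IsRegularLocalRing R] [𝔓.IsPrime] [IsLocalization.AtPrime L 𝔓] in
/-- The ideal of the family is the extension of `K₀ = (ψ c_i, f)`. [folklore] -/
theorem span_range_consFamily {m : ℕ} (f : Fin m → A) :
    Ideal.span (Set.range (consFamily c i L ψ f)) =
      (Ideal.ofList (ψ (c i) :: List.ofFn f)).map (algebraMap A L) := by
  rw [← Ideal.ofList_ofFn, ofFn_consFamily, Ideal.map_ofList, List.map_cons, List.map_ofFn]
  rfl

include hz h𝔓 in
/-- All members of the family lie in the maximal ideal of `L` (if the `f_k` lie in `𝔓`). [folklore] -/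
theorem consFamily_mem_maximalIdeal [IsLocalRing L] {m : ℕ} (f : Fin m → A) (hf : ∀ k, f k ∈ 𝔓)
    (k : Fin (m + 1)) : consFamily c i L ψ f k ∈ maximalIdeal L := by
  have hmem : ∀ a' ∈ 𝔓, algebraMap A L a' ∈ maximalIdeal L := fun a' ha' =>
    (IsLocalization.AtPrime.to_map_mem_maximal_iff L 𝔓 a').mpr ha'
  refine Fin.cases ?_ (fun k => ?_) k
  · exact hmem _ (map_centre_mem' c hz ψ 𝔓 h𝔓 i)
  · simp only [consFamily, Fin.cons_succ]
    exact hmem _ (hf k)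

/-- The `κ[T]`-algebra structure on `L/(ψ cᵢ)L` through `ε : κ[T] ≅ A/(ψ cᵢ)` and `A/(ψ cᵢ) → L/(ψ cᵢ)L` (as in
`BlowupChartRsop.quotBarAlgebra`, with the residue field `κ` as coefficients). [folklore] -/
@[reducible] def quotBarAlgebraκ : Algebra P Lb :=
  ((algebraMap (A ⧸ KA) Lb).comp ε.symm.symm.toRingHom).toAlgebra

include 𝔓 in
/-- `L/(ψ cᵢ)L` is a localisation of `κ[T]` (through `ε`), hence flat over it. [folklore] -/
theorem flat_quotBarκ :
    letI := quotBarAlgebraκ c i L ψ ε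
    Module.Flat P Lb := by
  letI := quotBarAlgebraκ c i L ψ ε
  have hloc := IsLocalization.isLocalization_of_base_ringEquiv
    (Algebra.algebraMapSubmonoid (A ⧸ KA) 𝔓.primeCompl) (Lb) ε.symm
  exact @IsLocalization.flat _ (Lb) _ _ (quotBarAlgebraκ c i L ψ ε) _ hloc

include hnzd 𝔓 in
/-- **The family is weakly regular on `L`** when the polynomial representatives `F_k` of the `f_k` modulo `ψ c_i` form a
weakly regular sequence on `κ[T]`: `ψ c_i` is a non-zero-divisor, and modulo it the `f_k` are the images of the `F_k` in the
flat `κ[T]`-algebra `L/(ψ c_i)L`. [folklore] -/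
theorem isWeaklyRegular_consFamily {m : ℕ} (f : Fin m → A) (F : Fin m → P)
    (hfF : ∀ k, ε (F k) = Ideal.Quotient.mk _ (f k))
    (hF : RingTheory.Sequence.IsWeaklyRegular P (List.ofFn F)) :
    RingTheory.Sequence.IsWeaklyRegular L (List.ofFn (consFamily c i L ψ f)) := by
  rw [ofFn_consFamily, RingTheory.Sequence.isWeaklyRegular_cons_iff]
  constructor
  · exact Module.Flat.isSMulRegular_of_nonZeroDivisors
      (algebraMap_centre_mem_nonZeroDivisors c i L ψ hnzd 𝔓)
  · letI := quotBarAlgebraκ c i L ψ ε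
    haveI := flat_quotBarκ c i L ψ ε 𝔓
    have hLbar := hF.of_flat (S := Lb)
    rw [List.map_ofFn] at hLbar
    have halg : ∀ k, algebraMap P Lb (F k) = Ideal.Quotient.mk KL (algebraMap A L (f k)) := by
      intro k
      change (algebraMap (A ⧸ KA) Lb) (ε.symm.symm (F k)) = _
      rw [RingEquiv.symm_symm, hfF]
      rfl
    simp only [Function.comp_def, halg] at hLbar
    have hLbar' : RingTheory.Sequence.IsWeaklyRegular Lb (List.ofFn fun k => algebraMap A L (f k)) := by
      rw [← RingTheory.Sequence.isWeaklyRegular_map_algebraMap_iff Lb, List.map_ofFn]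
      exact hLbar
    have hKL : (algebraMap A L (ψ (c i)) • ⊤ : Submodule L L) = (KL).restrictScalars L := by
      rw [Ideal.map_span, Set.image_singleton, ← Submodule.ideal_span_singleton_smul, smul_eq_mul,
        Ideal.mul_top]
      rfl
    let eq : QuotSMulTop (algebraMap A L (ψ (c i))) L ≃ₗ[L] Lb := Submodule.quotEquivOfEq _ _ hKL
    exact (eq.isWeaklyRegular_congr _).mpr hLbar'

include hz hnzd h𝔓 in
/-- The family is a regular sequence on `L` (weakly regular, and its ideal is proper). [folklore] -/
theorem isRegular_consFamily [IsLocalRing L] {m : ℕ} (f : Fin m → A) (hf : ∀ k, f k ∈ 𝔓)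
    (F : Fin m → P) (hfF : ∀ k, ε (F k) = Ideal.Quotient.mk _ (f k))
    (hF : RingTheory.Sequence.IsWeaklyRegular P (List.ofFn F)) :
    RingTheory.Sequence.IsRegular L (List.ofFn (consFamily c i L ψ f)) := by
  refine ⟨isWeaklyRegular_consFamily c i L ψ hnzd ε 𝔓 f F hfF hF, ?_⟩
  rw [smul_eq_mul, Ideal.mul_top, Ideal.ofList_ofFn]
  intro htop
  have h1 : (Ideal.span (Set.range (consFamily c i L ψ f))) ≤ maximalIdeal L :=
    Ideal.span_le.mpr (by rintro _ ⟨k, rfl⟩; exact consFamily_mem_maximalIdeal c i hz L ψ 𝔓 h𝔓 f hf k)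
  rw [← htop] at h1
  exact (maximalIdeal.isMaximal L).ne_top (top_le_iff.mp h1)

include hz hnzd h𝔓 in
/-- **Dimension count**: `dim L/(ψ c_i, f) + (m + 1) = dim L`. [cite: Matsumura1987, Thm. 17.4] -/
theorem ringKrullDim_quot_consFamily_add [IsNoetherianRing A] [IsLocalRing L] {m : ℕ}
    (f : Fin m → A) (hf : ∀ k, f k ∈ 𝔓)
    (F : Fin m → P) (hfF : ∀ k, ε (F k) = Ideal.Quotient.mk _ (f k))
    (hF : RingTheory.Sequence.IsWeaklyRegular P (List.ofFn F)) :
    ringKrullDim (L ⧸ Ideal.span (Set.range (consFamily c i L ψ f))) + (m + 1 : ℕ) = ringKrullDim L := by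
  haveI : IsNoetherianRing L := IsLocalization.isNoetherianRing 𝔓.primeCompl L inferInstance
  have h := Module.supportDim_add_length_eq_supportDim_of_isRegular (M := L) _
    (isRegular_consFamily c i hz L ψ hnzd ε 𝔓 h𝔓 f hf F hfF hF)
  rw [List.length_ofFn, Module.supportDim_self_eq_ringKrullDim] at h
  rw [← h, ← Module.supportDim_quotient_eq_ringKrullDim]
  congr 1
  refine Module.supportDim_eq_of_equiv (Submodule.quotEquivOfEq _ _ ?_)
  rw [smul_eq_mul, Ideal.mul_top, Ideal.ofList_ofFn]

include hz hnzd h𝔓 in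
/-- **Main abstract statement.**  If the `f_k ∈ 𝔓` have polynomial representatives forming a weakly regular sequence on
`κ[T]`, and `L/(ψ c_i, f)L` is a regular local ring, then `(ψ c_i, f₁, …, f_m)` is part of a regular system of parameters of
`L`. [cite: Matsumura1987, Thm. 14.2 (Remark)] -/
theorem isRsopPart_consFamily [IsNoetherianRing A] [IsLocalRing L] {m : ℕ}
    (f : Fin m → A) (hf : ∀ k, f k ∈ 𝔓)
    (F : Fin m → P) (hfF : ∀ k, ε (F k) = Ideal.Quotient.mk _ (f k))
    (hF : RingTheory.Sequence.IsWeaklyRegular P (List.ofFn F))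
    [hreg : IsRegularLocalRing (L ⧸ (Ideal.ofList (ψ (c i) :: List.ofFn f)).map (algebraMap A L))] :
    IsRsopPart (consFamily c i L ψ f) := by
  haveI : IsNoetherianRing L := IsLocalization.isNoetherianRing 𝔓.primeCompl L inferInstance
  haveI : IsRegularLocalRing (L ⧸ Ideal.span (Set.range (consFamily c i L ψ f))) := by
    rw [span_range_consFamily]; exact hreg
  refine IsRsopPart.of_isRegularLocalRing_quotient (consFamily_mem_maximalIdeal c i hz L ψ 𝔓 h𝔓 f hf) ?_
  exact (ringKrullDim_quot_consFamily_add c i hz L ψ hnzd ε 𝔓 h𝔓 f hf F hfF hF).le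

end AbstractChart

end ConeDepth

end Summit.ResolutionOfSingularities.ResolutionOfSingularities.Theorems

end
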